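import Mathlib
import Literature.NumberTheory.Sieve.Maynard2016CoupledLocal
import Literature.NumberTheory.Sieve.Maynard2016CoupledKernelW
import HarnessLib

/-!
# Maynard (2016), Lemma 7: the weighted local factors `K^w_p` versus `K_p`

Topic `Literature/NumberTheory/Sieve`; trunk AntSieve / parity (Maynard 2016 large-gaps ladder, named
fact `Literature.NumberTheory.Sieve.Maynard2016.Lemma7Tuple` of `Maynard2016Lemma7PerTuple.lean`).

J. Maynard, *Large gaps between primes*, Ann. of Math. (2) 183 (2016), 915–933 = arXiv:1408.5110,
§6, Lemma 7, display (6.32): the main term of Lemma 7 is the sum (6.10) of Lemma 6 with the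
denominator `[d,d',e,e']` replaced by `φ([d,d',e,e'])` ("and so, following the argument of Lemma 6 we
obtain (6.32)").  In the language of `Maynard2016CoupledEulerW` / `Maynard2016CoupledKernelW` the local
factor becomes `K^w_p = 1 + w(p) X_p` instead of `K_p = 1 + X_p/p`, with the SAME slot sum `X_p`
(`slotSum`).  Hence `K^w_p − K_p = (w(p) − 1/p) X_p` (`coupledLocalFactorW_sub`), and for an
`IsLcmWeight` (`|w(p) − 1/p| ≤ 2/p²`, e.g. `1/φ`: `PolymathLcmSumsEuler.isLcmWeight_totient_inv`)
`|K^w_p − K_p| ≤ 2(3k + 3k' + 9kk')/p²` (`norm_coupledLocalFactorMuW_sub_le`): the modification is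
absorbed into the `1 + O(1/p²)` factor of (6.13).  Concretely, with `η^w_p` defined by
`K^w_p = (1 + η^w_p) B_p(s,s') B_p(r,r') (1 + ν_p/p)` (`coupledEpsW`, `coupledLocalFactorMuW_eq_mul`),
`|η^w_p − η_p| ≤ 6^{k+k'} · 2(3k + 3k' + 9kk')/p²` (`norm_coupledEpsW_sub_coupledEps_le`) and the
bounds `norm_coupledEps_le` / `norm_coupledEps_le_of_good` of `Maynard2016CoupledLocal` transfer
(`norm_coupledEpsW_le`, `norm_coupledEpsW_le_of_good`).

## References

* J. Maynard, *Large gaps between primes*, Ann. of Math. (2) 183 (2016), 915–933; arXiv:1408.5110,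
  §6, (6.11)–(6.13) and (6.32). [Maynard2016LargeGaps]
* D. H. J. Polymath, *Variants of the Selberg sieve, and bounded intervals containing many primes*,
  Res. Math. Sci. 1 (2014), Lemma 4.1 (last paragraph of the proof). [Polymath8b2014]
-/

noncomputable section

open Finset
open scoped BigOperators ArithmeticFunction.Moebius Classical

namespace Literature.NumberTheory.Sieve

namespace LcmEuler

variable {ι κ : Type*} [Fintype ι] [Fintype κ]

/-! ### The slot sum `X_p` and `K^w_p − K_p` -/

/-- The slot sum `X_p = Σ_i A_i + [p ∤ m](Σ_j B_j + Σ_{(i,j) ∈ M_p} A_i B_j)` shared by `K_p = 1 + X_p/p`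
and `K^w_p = 1 + w(p) X_p`. [cite: Maynard2016LargeGaps, §6 displays (6.11)–(6.13)] -/
def slotSum (g h : ι → ℕ → ℂ) (g' h' : κ → ℕ → ℂ) (m : ℕ) (M : ℕ → Finset (ι × κ)) (q : ℕ) : ℂ :=
  (∑ i, slotTerm g h q i) +
    (if q ∣ m then 0 else (∑ j, slotTerm g' h' q j) + ∑ p ∈ M q, slotTerm g h q p.1 * slotTerm g' h' q p.2)

/-- `K^w_p = 1 + w(p) X_p`. [cite: Maynard2016LargeGaps, §6 display (6.32)] -/
theorem coupledLocalFactorW_eq_one_add (g h : ι → ℕ → ℂ) (g' h' : κ → ℕ → ℂ) (w : ℕ → ℂ) (m : ℕ)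
    (M : ℕ → Finset (ι × κ)) (q : ℕ) :
    coupledLocalFactorW g h g' h' w m M q = 1 + w q * slotSum g h g' h' m M q := rfl

/-- `K_p = 1 + X_p/p`. [cite: Maynard2016LargeGaps, §6 display (6.11)] -/
theorem coupledLocalFactor_eq_one_add (g h : ι → ℕ → ℂ) (g' h' : κ → ℕ → ℂ) (m : ℕ)
    (M : ℕ → Finset (ι × κ)) (q : ℕ) :
    coupledLocalFactor g h g' h' m M q = 1 + slotSum g h g' h' m M q / q := rfl

/-- **`K^w_p − K_p = (w(p) − 1/p) X_p`.** [cite: Maynard2016LargeGaps, §6 display (6.32)] -/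
theorem coupledLocalFactorW_sub (g h : ι → ℕ → ℂ) (g' h' : κ → ℕ → ℂ) (w : ℕ → ℂ) (m : ℕ)
    (M : ℕ → Finset (ι × κ)) (q : ℕ) :
    coupledLocalFactorW g h g' h' w m M q - coupledLocalFactor g h g' h' m M q =
      (w q - (q : ℂ)⁻¹) * slotSum g h g' h' m M q := by
  rw [coupledLocalFactorW_eq_one_add, coupledLocalFactor_eq_one_add, div_eq_mul_inv]
  ring

/-- At a prime the Möbius slot sum is `Σ_i σ_i + [p ∤ m](Σ_j σ'_j + Σ_{M_p} σ_i σ'_j)`.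
[cite: Maynard2016LargeGaps, §6 displays (6.11)–(6.13)] -/
theorem slotSum_moebiusWeight (m : ℕ) (M : ℕ → Finset (ι × κ)) (a b : ι → ℂ) (a' b' : κ → ℂ)
    {q : ℕ} (hq : q.Prime) :
    slotSum (moebiusWeight a) (moebiusWeight b) (moebiusWeight a') (moebiusWeight b') m M q =
      (∑ i, muSlot a b q i) + (if q ∣ m then 0 else (∑ j, muSlot a' b' q j) + couplingSum M a b a' b' q) := by
  unfold slotSum couplingSum
  simp_rw [slotTerm_moebiusWeight _ _ hq]

/-- `|X_p| ≤ 3k + 3k' + 9kk'` at a prime when all exponents have real part `≥ 0`.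
[cite: Maynard2016LargeGaps, §6 display (6.11)] -/
theorem norm_slotSum_moebiusWeight_le {m : ℕ} {M : ℕ → Finset (ι × κ)} {a b : ι → ℂ} {a' b' : κ → ℂ}
    (hab : ∀ i, 0 ≤ (a i).re ∧ 0 ≤ (b i).re) (hab' : ∀ j, 0 ≤ (a' j).re ∧ 0 ≤ (b' j).re)
    {q : ℕ} (hq : q.Prime) :
    ‖slotSum (moebiusWeight a) (moebiusWeight b) (moebiusWeight a') (moebiusWeight b') m M q‖ ≤
      3 * Fintype.card ι + 3 * Fintype.card κ + 9 * Fintype.card ι * Fintype.card κ := by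
  rw [slotSum_moebiusWeight m M a b a' b' hq]
  have hA : ∀ i, ‖muSlot a b q i‖ ≤ 3 := fun i => norm_muSlot_le hq.pos (hab i).1 (hab i).2
  have hB : ∀ j, ‖muSlot a' b' q j‖ ≤ 3 := fun j => norm_muSlot_le hq.pos (hab' j).1 (hab' j).2
  have hSA : ‖∑ i, muSlot a b q i‖ ≤ 3 * Fintype.card ι := by
    refine (norm_sum_le _ _).trans ?_
    calc _ ≤ ∑ _i : ι, (3 : ℝ) := Finset.sum_le_sum fun i _ => hA i
      _ = _ := by rw [Finset.sum_const, Finset.card_univ, nsmul_eq_mul]; ring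
  have hSB : ‖∑ j, muSlot a' b' q j‖ ≤ 3 * Fintype.card κ := by
    refine (norm_sum_le _ _).trans ?_
    calc _ ≤ ∑ _j : κ, (3 : ℝ) := Finset.sum_le_sum fun j _ => hB j
      _ = _ := by rw [Finset.sum_const, Finset.card_univ, nsmul_eq_mul]; ring
  have hSM : ‖couplingSum M a b a' b' q‖ ≤ 9 * Fintype.card ι * Fintype.card κ := by
    unfold couplingSum
    refine (norm_sum_le _ _).trans ?_
    have hle : ∀ p ∈ M q, ‖muSlot a b q p.1 * muSlot a' b' q p.2‖ ≤ 9 := by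
      intro p _
      rw [norm_mul]
      calc _ ≤ (3 : ℝ) * 3 := mul_le_mul (hA p.1) (hB p.2) (norm_nonneg _) (by norm_num)
        _ = 9 := by norm_num
    calc _ ≤ ∑ _p ∈ M q, (9 : ℝ) := Finset.sum_le_sum hle
      _ = (M q).card * 9 := by rw [Finset.sum_const, nsmul_eq_mul]
      _ ≤ (Fintype.card ι * Fintype.card κ : ℝ) * 9 := by
          have hc : ((M q).card : ℝ) ≤ Fintype.card ι * Fintype.card κ := by
            have := Finset.card_le_card (Finset.subset_univ (M q))
            rw [Finset.card_univ, Fintype.card_prod] at this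
            exact_mod_cast this
          gcongr
      _ = _ := by ring
  refine (norm_add_le _ _).trans ?_
  have hite : ‖(if q ∣ m then (0 : ℂ) else (∑ j, muSlot a' b' q j) + couplingSum M a b a' b' q)‖ ≤
      3 * Fintype.card κ + 9 * Fintype.card ι * Fintype.card κ := by
    split_ifs
    · rw [norm_zero]; positivity
    · exact (norm_add_le _ _).trans (add_le_add hSB hSM)
  linarith

/-- **`K^w_p − K_p = (w(p) − 1/p) X_p`** for the Möbius weights.
[cite: Maynard2016LargeGaps, §6 display (6.32)] -/
theorem coupledLocalFactorMuW_sub (w : ℕ → ℂ) (m : ℕ) (M : ℕ → Finset (ι × κ)) (a b : ι → ℂ)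
    (a' b' : κ → ℂ) (q : ℕ) :
    coupledLocalFactorMuW w m M a b a' b' q - coupledLocalFactorMu m M a b a' b' q =
      (w q - (q : ℂ)⁻¹) *
        slotSum (moebiusWeight a) (moebiusWeight b) (moebiusWeight a') (moebiusWeight b') m M q :=
  coupledLocalFactorW_sub _ _ _ _ _ _ _ _

/-- **`|K^w_p − K_p| ≤ 2(3k + 3k' + 9kk')/p²`** for an `IsLcmWeight w` ("this modification may be
absorbed into the `1 + O(1/p²)` factor").
[cite: Maynard2016LargeGaps, §6 display (6.32)] -/
theorem norm_coupledLocalFactorMuW_sub_le {w : ℕ → ℂ} (hw : IsLcmWeight w) {m : ℕ}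
    {M : ℕ → Finset (ι × κ)} {a b : ι → ℂ} {a' b' : κ → ℂ} (hab : ∀ i, 0 ≤ (a i).re ∧ 0 ≤ (b i).re)
    (hab' : ∀ j, 0 ≤ (a' j).re ∧ 0 ≤ (b' j).re) {q : ℕ} (hq : q.Prime) :
    ‖coupledLocalFactorMuW w m M a b a' b' q - coupledLocalFactorMu m M a b a' b' q‖ ≤
      2 / (q : ℝ) ^ 2 * (3 * Fintype.card ι + 3 * Fintype.card κ + 9 * Fintype.card ι * Fintype.card κ) := by
  rw [coupledLocalFactorMuW_sub, norm_mul]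
  exact mul_le_mul (hw.sub_le q hq) (norm_slotSum_moebiusWeight_le hab hab' hq) (norm_nonneg _)
    (by positivity)

/-! ### The relative error `η^w_p` -/

/-- **`η^w_p`**, defined by `K^w_p = (1 + η^w_p) B_p(s,s') B_p(r,r') (1 + ν_p/p)`.
[cite: Maynard2016LargeGaps, §6 displays (6.13), (6.32)] -/
def coupledEpsW (w : ℕ → ℂ) (m : ℕ) (M : ℕ → Finset (ι × κ)) (a b : ι → ℂ) (a' b' : κ → ℂ)
    (q : ℕ) : ℂ :=
  coupledLocalFactorMuW w m M a b a' b' q /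
      (zetaFactor a b q * zetaFactor a' b' q * (1 + (coupledNu m M q : ℂ) / q)) - 1

/-- **`K^w_p = (1 + η^w_p) · B_p(s,s') B_p(r,r') · (1 + ν_p/p)`** (exponents of real part `≥ 0`,
`p ≥ 2`). [cite: Maynard2016LargeGaps, §6 displays (6.13), (6.32)] -/
theorem coupledLocalFactorMuW_eq_mul (w : ℕ → ℂ) {m : ℕ} {M : ℕ → Finset (ι × κ)} {a b : ι → ℂ}
    {a' b' : κ → ℂ} (hab : ∀ i, 0 ≤ (a i).re ∧ 0 ≤ (b i).re)
    (hab' : ∀ j, 0 ≤ (a' j).re ∧ 0 ≤ (b' j).re) {q : ℕ} (hq : 2 ≤ q) :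
    coupledLocalFactorMuW w m M a b a' b' q =
      (1 + coupledEpsW w m M a b a' b' q) *
        (zetaFactor a b q * zetaFactor a' b' q * (1 + (coupledNu m M q : ℂ) / q)) := by
  have hne : zetaFactor a b q * zetaFactor a' b' q * (1 + (coupledNu m M q : ℂ) / q) ≠ 0 :=
    mul_ne_zero (mul_ne_zero (zetaFactor_ne_zero hab hq) (zetaFactor_ne_zero hab' hq))
      (one_add_coupledNu_div_ne_zero m M q)
  unfold coupledEpsW
  rw [add_sub_cancel, div_mul_cancel₀ _ hne]

/-- `η^w_p − η_p = (K^w_p − K_p)/P_p`. [cite: Maynard2016LargeGaps, §6 display (6.32)] -/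
theorem coupledEpsW_sub_coupledEps (w : ℕ → ℂ) (m : ℕ) (M : ℕ → Finset (ι × κ)) (a b : ι → ℂ)
    (a' b' : κ → ℂ) (q : ℕ) :
    coupledEpsW w m M a b a' b' q - coupledEps m M a b a' b' q =
      (coupledLocalFactorMuW w m M a b a' b' q - coupledLocalFactorMu m M a b a' b' q) /
        (zetaFactor a b q * zetaFactor a' b' q * (1 + (coupledNu m M q : ℂ) / q)) := by
  unfold coupledEpsW coupledEps
  rw [sub_div]
  ring

/-- **`|η^w_p − η_p| ≤ 6^{k+k'} · 2(3k + 3k' + 9kk')/p²`** for an `IsLcmWeight w`.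
[cite: Maynard2016LargeGaps, §6 display (6.32)] -/
theorem norm_coupledEpsW_sub_coupledEps_le {w : ℕ → ℂ} (hw : IsLcmWeight w) {m : ℕ}
    {M : ℕ → Finset (ι × κ)} {a b : ι → ℂ} {a' b' : κ → ℂ} (hab : ∀ i, 0 ≤ (a i).re ∧ 0 ≤ (b i).re)
    (hab' : ∀ j, 0 ≤ (a' j).re ∧ 0 ≤ (b' j).re) {q : ℕ} (hq : q.Prime) :
    ‖coupledEpsW w m M a b a' b' q - coupledEps m M a b a' b' q‖ ≤
      6 ^ (Fintype.card ι + Fintype.card κ) *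
        (2 / (q : ℝ) ^ 2 * (3 * Fintype.card ι + 3 * Fintype.card κ + 9 * Fintype.card ι * Fintype.card κ)) := by
  have hq2 := hq.two_le
  have hP := norm_zetaFactor_mul_ge (m := m) (M := M) hab hab' hq2
  have hP0 : (0 : ℝ) < (1 / 6 : ℝ) ^ (Fintype.card ι + Fintype.card κ) := by positivity
  have hnum := norm_coupledLocalFactorMuW_sub_le (m := m) (M := M) hw hab hab' hq
  rw [coupledEpsW_sub_coupledEps, norm_div, div_le_iff₀ (hP0.trans_le hP)]
  set P := zetaFactor a b q * zetaFactor a' b' q * (1 + (coupledNu m M q : ℂ) / q)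
  set X := 2 / (q : ℝ) ^ 2 * (3 * Fintype.card ι + 3 * Fintype.card κ + 9 * Fintype.card ι * Fintype.card κ)
  have hX0 : 0 ≤ X := by positivity
  have h6 : (6 : ℝ) ^ (Fintype.card ι + Fintype.card κ) * (1 / 6 : ℝ) ^ (Fintype.card ι + Fintype.card κ) = 1 := by
    rw [← mul_pow]; norm_num
  calc _ ≤ X := hnum
    _ = 6 ^ (Fintype.card ι + Fintype.card κ) * X * (1 / 6 : ℝ) ^ (Fintype.card ι + Fintype.card κ) := by
        rw [mul_comm _ X, mul_assoc, h6, mul_one]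
    _ ≤ 6 ^ (Fintype.card ι + Fintype.card κ) * X * ‖P‖ := by gcongr

/-- **`η^w_p ≪ k²/p² + k² τ log p / p` for `p > y`** (all primes `p ≥ 7k, 7k'`), the weighted version of
`norm_coupledEps_le`. [cite: Maynard2016LargeGaps, §6 displays (6.13), (6.32)] -/
theorem norm_coupledEpsW_le {w : ℕ → ℂ} (hw : IsLcmWeight w) {m : ℕ} {M : ℕ → Finset (ι × κ)}
    {a b : ι → ℂ} {a' b' : κ → ℂ} (hab : ∀ i, 0 ≤ (a i).re ∧ 0 ≤ (b i).re)
    (hab' : ∀ j, 0 ≤ (a' j).re ∧ 0 ≤ (b' j).re) {q : ℕ} (hq : q.Prime)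
    (hqk : 7 * Fintype.card ι ≤ q) (hqk' : 7 * Fintype.card κ ≤ q) {τ : ℝ} (hτ0 : 0 ≤ τ)
    (ha : ∀ i, ‖a i‖ ≤ τ) (ha' : ∀ j, ‖a' j‖ ≤ τ) :
    ‖coupledEpsW w m M a b a' b' q‖ ≤
      6 ^ (Fintype.card ι + Fintype.card κ) *
        (badConst (Fintype.card ι) (Fintype.card κ) / (q : ℝ) ^ 2 +
          16 * (Fintype.card κ + Fintype.card ι * Fintype.card κ) * (τ * Real.log q) / q) +
      6 ^ (Fintype.card ι + Fintype.card κ) *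
        (2 / (q : ℝ) ^ 2 * (3 * Fintype.card ι + 3 * Fintype.card κ + 9 * Fintype.card ι * Fintype.card κ)) := by
  have h1 := norm_coupledEps_le (m := m) (M := M) hab hab' hq hqk hqk' hτ0 ha ha'
  have h2 := norm_coupledEpsW_sub_coupledEps_le (m := m) (M := M) hw hab hab' hq
  calc ‖coupledEpsW w m M a b a' b' q‖
      = ‖coupledEps m M a b a' b' q + (coupledEpsW w m M a b a' b' q - coupledEps m M a b a' b' q)‖ := by
        rw [add_sub_cancel]
    _ ≤ _ := (norm_add_le _ _).trans (add_le_add h1 h2)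

/-- **`η^w_p ≪ k²/p²` at good primes** (`p ∤ m`, `M_p = ∅`), the weighted version of
`norm_coupledEps_le_of_good`. [cite: Maynard2016LargeGaps, §6 displays (6.12), (6.32)] -/
theorem norm_coupledEpsW_le_of_good {w : ℕ → ℂ} (hw : IsLcmWeight w) {m : ℕ} {M : ℕ → Finset (ι × κ)}
    {a b : ι → ℂ} {a' b' : κ → ℂ} (hab : ∀ i, 0 ≤ (a i).re ∧ 0 ≤ (b i).re)
    (hab' : ∀ j, 0 ≤ (a' j).re ∧ 0 ≤ (b' j).re) {q : ℕ} (hq : q.Prime)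
    (hqk : 7 * Fintype.card ι ≤ q) (hqk' : 7 * Fintype.card κ ≤ q) (hqm : ¬ q ∣ m) (hM : M q = ∅) :
    ‖coupledEpsW w m M a b a' b' q‖ ≤
      6 ^ (Fintype.card ι + Fintype.card κ) *
        (goodConst (Fintype.card ι) (Fintype.card κ) / (q : ℝ) ^ 2) +
      6 ^ (Fintype.card ι + Fintype.card κ) *
        (2 / (q : ℝ) ^ 2 * (3 * Fintype.card ι + 3 * Fintype.card κ + 9 * Fintype.card ι * Fintype.card κ)) := by
  have h1 := norm_coupledEps_le_of_good (m := m) hab hab' hq hqk hqk' hqm hM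
  have h2 := norm_coupledEpsW_sub_coupledEps_le (m := m) (M := M) hw hab hab' hq
  calc ‖coupledEpsW w m M a b a' b' q‖
      = ‖coupledEps m M a b a' b' q + (coupledEpsW w m M a b a' b' q - coupledEps m M a b a' b' q)‖ := by
        rw [add_sub_cancel]
    _ ≤ _ := (norm_add_le _ _).trans (add_le_add h1 h2)

end LcmEuler

end Literature.NumberTheory.Sieve

end
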